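import Literature.Algebra.EuclideanLattices.IntegerBases
import HarnessLib

/-!
# Cubic lattice patches: many well-separated points in a small region of `ℝⁿ`

One elementary counting fact of discrete geometry in `ℝⁿ = EuclideanSpace ℝ (Fin n)`, proved:

* `exists_separated_lattice` — around any `y₁` and for any spacing `s > 0` and size `K` there
  are `(2K + 1)ⁿ` points, pairwise at distance `≥ s`, within `s √n K` of `y₁` (the points
  `y₁ + s k`, `k ∈ {-K, …, K}ⁿ`, through the tree's integer embedding
  `Literature.Algebra.EuclideanLattices.intVecToEuclidean`), with the two norm bounds on integer
  vectors it needs (`one_le_norm_intVecToEuclidean`, `norm_intVecToEuclidean_le`).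

Together with the packing bound already in the tree
(`Literature.MathematicalPhysics.StatisticalMechanics.card_le_of_separated_of_dist_le`: at most
`(2R/r + 1)ⁿ` points of a ball of radius `R` at mutual distance `≥ r`) this is the counting
input of the packing argument of `Literature/Geometry/Lorentzian/EuclideanOfFlat.lean`.

## References

* J. Matoušek, *Lectures on Discrete Geometry*, GTM 212, Springer (2002), §13.1 (packing and
  the volume argument). [Matousek2002]
-/

noncomputable section

open Set Finset Metric

namespace Literature.Geometry.DiscreteGeometry.CubePacking

open Literature.Algebra.EuclideanLattices

variable {n : ℕ}

/-- A nonzero integer vector has Euclidean norm at least `1`. [folklore] -/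
theorem one_le_norm_intVecToEuclidean {k : Fin n → ℤ} (hk : k ≠ 0) :
    1 ≤ ‖intVecToEuclidean n k‖ := by
  obtain ⟨i, hi⟩ : ∃ i, k i ≠ 0 := by
    by_contra h; push Not at h; exact hk (funext h)
  have h1 : (1 : ℝ) ≤ |(k i : ℝ)| := by
    rw [← Int.cast_abs]; exact_mod_cast Int.one_le_abs hi
  have h2 : |(k i : ℝ)| ≤ ‖intVecToEuclidean n k‖ := by
    simpa [Real.norm_eq_abs, intVecToEuclidean_apply] using PiLp.norm_apply_le (intVecToEuclidean n k) i
  exact h1.trans h2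

/-- The norm of an integer vector with coordinates bounded by `K` is at most `√n K`. [folklore] -/
theorem norm_intVecToEuclidean_le {k : Fin n → ℤ} {K : ℕ} (hk : ∀ i, |k i| ≤ K) :
    ‖intVecToEuclidean n k‖ ≤ Real.sqrt n * K := by
  rw [norm_intVecToEuclidean]
  have h : ∑ i, ((k i : ℝ)) ^ 2 ≤ n * (K : ℝ) ^ 2 := by
    calc ∑ i, ((k i : ℝ)) ^ 2 ≤ ∑ _i : Fin n, (K : ℝ) ^ 2 := by
          refine Finset.sum_le_sum fun i _ ↦ ?_
          rw [← sq_abs]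
          have : |(k i : ℝ)| ≤ K := by rw [← Int.cast_abs]; exact_mod_cast hk i
          exact pow_le_pow_left₀ (abs_nonneg _) this 2
      _ = n * (K : ℝ) ^ 2 := by simp
  calc √(∑ i, ((k i : ℝ)) ^ 2) ≤ √(n * (K : ℝ) ^ 2) := Real.sqrt_le_sqrt h
    _ = Real.sqrt n * K := by rw [Real.sqrt_mul (by positivity), Real.sqrt_sq (by positivity)]

/-- **Cubic lattice patches.** Around any point `y₁` and for any spacing `s > 0` and size `K`
there is a set of `(2K + 1)ⁿ` points, pairwise at distance `≥ s`, within distance `s √n K`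
of `y₁` (the points `y₁ + s k`, `k ∈ {-K, …, K}ⁿ`). (The counting half of the volume
argument, Matoušek 2002, §13.1.) [folklore] -/
theorem exists_separated_lattice (y₁ : EuclideanSpace ℝ (Fin n)) {s : ℝ} (hs : 0 < s) (K : ℕ) :
    ∃ Λ : Finset (EuclideanSpace ℝ (Fin n)), Λ.card = (2 * K + 1) ^ n ∧
      (∀ y ∈ Λ, ‖y - y₁‖ ≤ s * Real.sqrt n * K) ∧
      ∀ y ∈ Λ, ∀ y' ∈ Λ, y ≠ y' → s ≤ ‖y - y'‖ := by
  classical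
  set B : Finset (Fin n → ℤ) := Fintype.piFinset fun _ ↦ Finset.Icc (-(K : ℤ)) K with hB
  set φ : (Fin n → ℤ) → EuclideanSpace ℝ (Fin n) := fun k ↦ y₁ + s • intVecToEuclidean n k with hφ
  have hφinj : Function.Injective φ := by
    intro k k' h
    have h1 : s • intVecToEuclidean n k = s • intVecToEuclidean n k' := add_left_cancel h
    exact intVecToEuclidean_injective n (smul_right_injective _ hs.ne' h1)
  refine ⟨B.image φ, ?_, fun y hy ↦ ?_, fun y hy y' hy' hne ↦ ?_⟩
  · rw [Finset.card_image_of_injective _ hφinj, hB, Fintype.card_piFinset, Finset.prod_const,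
      Finset.card_univ, Fintype.card_fin, Int.card_Icc]
    congr 1; omega
  · obtain ⟨k, hk, rfl⟩ := Finset.mem_image.1 hy
    have hk' : ∀ i, |k i| ≤ K := fun i ↦ by
      have := Finset.mem_Icc.1 (Fintype.mem_piFinset.1 hk i); exact abs_le.2 ⟨this.1, this.2⟩
    rw [hφ]; simp only [add_sub_cancel_left, norm_smul, Real.norm_eq_abs, abs_of_pos hs]
    calc s * ‖intVecToEuclidean n k‖ ≤ s * (Real.sqrt n * K) :=
          mul_le_mul_of_nonneg_left (norm_intVecToEuclidean_le hk') hs.le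
      _ = s * Real.sqrt n * K := by ring
  · obtain ⟨k, -, rfl⟩ := Finset.mem_image.1 hy
    obtain ⟨k', -, rfl⟩ := Finset.mem_image.1 hy'
    have hkk : k - k' ≠ 0 := fun h ↦ hne (by rw [sub_eq_zero.1 h])
    rw [hφ]
    simp only [add_sub_add_left_eq_sub, ← smul_sub, ← map_sub, norm_smul, Real.norm_eq_abs,
      abs_of_pos hs]
    calc s = s * 1 := (mul_one s).symm
      _ ≤ s * ‖intVecToEuclidean n (k - k')‖ :=
          mul_le_mul_of_nonneg_left (one_le_norm_intVecToEuclidean hkk) hs.le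

end Literature.Geometry.DiscreteGeometry.CubePacking

end
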